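import Mathlib
import Summits.MatrixMultiplication.MatrixMultiplication.Theorems.FidelityWitnessesRankTwoAdditivityToolkit
import Summits.MatrixMultiplication.MatrixMultiplication.Theorems.FidelityWitnessesRankTwoAdditivityBalChain

/-!
# `FidelityWitnesses.RankTwoAdditivity` (stmt-MatrixMultiplication-4964) — key lemma, balanced case (wiring)

Gram matrices of `Q_k* b` (PSD, quadratic form, `1 − D − D₁ ⪰ 0` by Bessel), the `K`-twisted inner products
(`ip_twist`), and the balanced case of the key lemma in unit form (`key_case_BAL_unit`), obtained by wiring the
vector data to the 2×2 chain `bal_chain` via the rank-two von Neumann bound `vn2`.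
Supports item `stmt-MatrixMultiplication-4964`; no definitions are introduced.
-/

namespace Summit.MatrixMultiplication.MatrixMultiplication.Theorems.RankTwoAdditivity

open scoped BigOperators ComplexConjugate ComplexOrder Matrix

/-- Gram matrix of two vectors (in the convention `D k l = ⟪h l, h k⟫`) is positive semidefinite. -/
theorem gram_psd_fin_two {μ : Type*} [Fintype μ] (h : Fin 2 → μ → ℂ) :
    (Matrix.of fun k l : Fin 2 => ∑ c, conj (h l c) * h k c).PosSemidef := by
  have : (Matrix.of fun k l : Fin 2 => ∑ c, conj (h l c) * h k c)
      = (Matrix.of fun (c : μ) (k : Fin 2) => conj (h k c))ᴴ * (Matrix.of fun (c : μ) (k : Fin 2) => conj (h k c)) := by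
    ext k l
    simp only [Matrix.of_apply, Matrix.mul_apply, Matrix.conjTranspose_apply, Complex.star_def, Complex.conj_conj]
    exact Finset.sum_congr rfl fun c _ => mul_comm _ _
  rw [this]
  exact Matrix.posSemidef_conjTranspose_mul_self _

/-- Quadratic form of the Gram matrix: `x* D x = ∑_c |∑_k conj(x_k) h k c|²` (as a complex number). -/
theorem gram_quad_fin_two {μ : Type*} [Fintype μ] (h : Fin 2 → μ → ℂ) (x : Fin 2 → ℂ) :
    star x ⬝ᵥ ((Matrix.of fun k l : Fin 2 => ∑ c, conj (h l c) * h k c) *ᵥ x)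
      = ((∑ c, ‖∑ k, conj (x k) * h k c‖ ^ 2 : ℝ) : ℂ) := by
  -- right-hand side as ∑_c z_c conj(z_c)
  have hR : ((∑ c, ‖∑ k, conj (x k) * h k c‖ ^ 2 : ℝ) : ℂ)
      = ∑ c, ∑ k, ∑ l, conj (x k) * h k c * (x l * conj (h l c)) := by
    push_cast
    refine Finset.sum_congr rfl fun c _ => ?_
    rw [← Complex.mul_conj', map_sum, Finset.sum_mul]
    refine Finset.sum_congr rfl fun k _ => ?_
    rw [Finset.mul_sum]
    refine Finset.sum_congr rfl fun l _ => ?_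
    rw [map_mul, Complex.conj_conj]
  have hL : star x ⬝ᵥ ((Matrix.of fun k l : Fin 2 => ∑ c, conj (h l c) * h k c) *ᵥ x)
      = ∑ k, ∑ l, ∑ c, conj (x k) * h k c * (x l * conj (h l c)) := by
    simp only [Matrix.mulVec, dotProduct, Matrix.of_apply, Pi.star_apply, Complex.star_def, Finset.mul_sum,
      Finset.sum_mul]
    refine Finset.sum_congr rfl fun k _ => Finset.sum_congr rfl fun l _ => Finset.sum_congr rfl fun c _ => ?_
    ring
  rw [hL, hR]
  have s1 : (∑ c, ∑ k, ∑ l, conj (x k) * h k c * (x l * conj (h l c)))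
      = ∑ k, ∑ c, ∑ l, conj (x k) * h k c * (x l * conj (h l c)) := Finset.sum_comm
  have s2 : ∀ k, (∑ c, ∑ l, conj (x k) * h k c * (x l * conj (h l c)))
      = ∑ l, ∑ c, conj (x k) * h k c * (x l * conj (h l c)) := fun k => Finset.sum_comm
  rw [s1]
  exact Finset.sum_congr rfl fun k _ => (s2 k).symm

/-- `‖∑_k x_k Q_k‖² = ∑ |x_k|²` for an HS-orthonormal pair `Q 0, Q 1`. -/
theorem norm_sq_comb_orthonormal {ν : Type*} [Fintype ν] (Q : Fin 2 → ν → ℂ)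
    (hQ : ∀ k l, (∑ c, conj (Q k c) * Q l c) = if k = l then 1 else 0) (x : Fin 2 → ℂ) :
    (∑ c, ‖∑ k, x k * Q k c‖ ^ 2) = ∑ k, ‖x k‖ ^ 2 := by
  simp only [Fin.sum_univ_two]
  have h := norm_sq_add_sum (fun c => x 0 * Q 0 c) (fun c => x 1 * Q 1 c)
  have e0 : (∑ c, ‖x 0 * Q 0 c‖ ^ 2) = ‖x 0‖ ^ 2 := by
    have : (∑ c, ‖x 0 * Q 0 c‖ ^ 2) = ‖x 0‖ ^ 2 * ∑ c, ‖Q 0 c‖ ^ 2 := by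
      rw [Finset.mul_sum]; exact Finset.sum_congr rfl fun c _ => by rw [norm_mul, mul_pow]
    rw [this]
    have h00 := hQ 0 0
    simp only [if_true] at h00
    have : (∑ c, ‖Q 0 c‖ ^ 2 : ℝ) = 1 := by
      have := congrArg Complex.re h00
      rw [Complex.re_sum] at this
      simp only [Complex.conj_mul', ← Complex.ofReal_pow, Complex.ofReal_re, Complex.one_re] at this
      exact this
    rw [this, mul_one]
  have e1 : (∑ c, ‖x 1 * Q 1 c‖ ^ 2) = ‖x 1‖ ^ 2 := by
    have : (∑ c, ‖x 1 * Q 1 c‖ ^ 2) = ‖x 1‖ ^ 2 * ∑ c, ‖Q 1 c‖ ^ 2 := by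
      rw [Finset.mul_sum]; exact Finset.sum_congr rfl fun c _ => by rw [norm_mul, mul_pow]
    rw [this]
    have h11 := hQ 1 1
    simp only [if_true] at h11
    have : (∑ c, ‖Q 1 c‖ ^ 2 : ℝ) = 1 := by
      have := congrArg Complex.re h11
      rw [Complex.re_sum] at this
      simp only [Complex.conj_mul', ← Complex.ofReal_pow, Complex.ofReal_re, Complex.one_re] at this
      exact this
    rw [this, mul_one]
  have e2 : (∑ c, conj (x 0 * Q 0 c) * (x 1 * Q 1 c)) = 0 := by
    have : (∑ c, conj (x 0 * Q 0 c) * (x 1 * Q 1 c)) = conj (x 0) * x 1 * ∑ c, conj (Q 0 c) * Q 1 c := by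
      rw [Finset.mul_sum]; exact Finset.sum_congr rfl fun c _ => by rw [map_mul]; ring
    rw [this, hQ 0 1]; simp
  rw [h, e0, e1, e2]; simp

/-- `1 − D − D₁ ⪰ 0` for the Gram matrices of `Q_k* b₀`, `Q_k* b₁` with `b₀ ⊥ b₁` unit and `Q` HS-orthonormal
(Bessel). -/
theorem one_sub_grams_psd {κ μ : Type*} [Fintype κ] [Fintype μ]
    (Q : Fin 2 → κ × μ → ℂ) (hQ : ∀ k l, (∑ c, conj (Q k c) * Q l c) = if k = l then 1 else 0)
    (b : Fin 2 → κ → ℂ) (hb₀ : (∑ m, ‖b 0 m‖ ^ 2) = 1) (hb₁ : (∑ m, ‖b 1 m‖ ^ 2) = 1)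
    (hb : (∑ m, conj (b 0 m) * b 1 m) = 0) :
    (1 - (Matrix.of fun k l : Fin 2 => ∑ c, conj (∑ m, conj (Q l (m, c)) * b 0 m) * ∑ m, conj (Q k (m, c)) * b 0 m)
       - (Matrix.of fun k l : Fin 2 => ∑ c, conj (∑ m, conj (Q l (m, c)) * b 1 m) * ∑ m, conj (Q k (m, c)) * b 1 m)).PosSemidef := by
  set h0 : Fin 2 → μ → ℂ := fun k c => ∑ m, conj (Q k (m, c)) * b 0 m with hh0
  set h1 : Fin 2 → μ → ℂ := fun k c => ∑ m, conj (Q k (m, c)) * b 1 m with hh1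
  have hD := gram_psd_fin_two h0
  have hD₁ := gram_psd_fin_two h1
  change (1 - (Matrix.of fun k l : Fin 2 => ∑ c, conj (h0 l c) * h0 k c)
    - (Matrix.of fun k l : Fin 2 => ∑ c, conj (h1 l c) * h1 k c)).PosSemidef
  apply Matrix.PosSemidef.of_dotProduct_mulVec_nonneg
  · exact (Matrix.isHermitian_one.sub hD.1).sub hD₁.1
  · intro x
    rw [Matrix.sub_mulVec, Matrix.sub_mulVec, Matrix.one_mulVec, dotProduct_sub, dotProduct_sub,
      gram_quad_fin_two h0 x, gram_quad_fin_two h1 x]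
    have hx : star x ⬝ᵥ x = ((∑ k, ‖x k‖ ^ 2 : ℝ) : ℂ) := by
      simp only [dotProduct, Pi.star_apply, Complex.star_def]; push_cast
      exact Finset.sum_congr rfl fun k _ => by rw [Complex.conj_mul']
    rw [hx]
    -- Bessel, column by column of Q_x = ∑ x_k Q_k
    have key : (∑ c, ‖∑ k, conj (x k) * h0 k c‖ ^ 2) + (∑ c, ‖∑ k, conj (x k) * h1 k c‖ ^ 2) ≤ ∑ k, ‖x k‖ ^ 2 := by
      have e : ∀ (bi : κ → ℂ) (c : μ), (∑ k, conj (x k) * ∑ m, conj (Q k (m, c)) * bi m)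
          = ∑ m, conj (∑ k, x k * Q k (m, c)) * bi m := by
        intro bi c
        simp only [Finset.mul_sum, map_sum, map_mul, Finset.sum_mul]
        rw [Finset.sum_comm]
        exact Finset.sum_congr rfl fun m _ => Finset.sum_congr rfl fun k _ => by ring
      have e' : ∀ c, (∑ k, conj (x k) * h0 k c) = ∑ m, conj (∑ k, x k * Q k (m, c)) * b 0 m := fun c => e (b 0) c
      have e'' : ∀ c, (∑ k, conj (x k) * h1 k c) = ∑ m, conj (∑ k, x k * Q k (m, c)) * b 1 m := fun c => e (b 1) c
      simp only [e', e'']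
      rw [← Finset.sum_add_distrib]
      have hbes : ∀ c, ‖∑ m, conj (∑ k, x k * Q k (m, c)) * b 0 m‖ ^ 2 + ‖∑ m, conj (∑ k, x k * Q k (m, c)) * b 1 m‖ ^ 2
          ≤ ∑ m, ‖∑ k, x k * Q k (m, c)‖ ^ 2 := by
        intro c
        have := bessel_pair (b 0) (b 1) (fun m => ∑ k, x k * Q k (m, c)) hb₀.le hb₁.le hb
        rwa [norm_hsum_comm (b 0), norm_hsum_comm (b 1)] at this
      refine le_trans (Finset.sum_le_sum fun c _ => hbes c) ?_
      have hQx : (∑ c, ∑ m, ‖∑ k, x k * Q k (m, c)‖ ^ 2) = ∑ k, ‖x k‖ ^ 2 := by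
        rw [Finset.sum_comm, ← Fintype.sum_prod_type (fun c' : κ × μ => ‖∑ k, x k * Q k c'‖ ^ 2)]
        exact norm_sq_comb_orthonormal Q hQ x
      rw [hQx]
    rw [Complex.nonneg_iff]
    constructor
    · simp only [Complex.sub_re, Complex.ofReal_re]; linarith
    · simp only [Complex.sub_im, Complex.ofReal_im]; simp


/-- Inner products of the `K`-twisted family `aa l = ∑_k conj(K k l) • h k` in terms of the Gram atoms. -/
theorem ip_twist {μ : Type*} [Fintype μ] (K : Matrix (Fin 2) (Fin 2) ℂ) (h : Fin 2 → μ → ℂ) (l l' : Fin 2) :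
    (∑ i, conj (∑ k, conj (K k l) * h k i) * ∑ k, conj (K k l') * h k i)
      = ∑ k, ∑ k', K k l * conj (K k' l') * ∑ i, conj (h k i) * h k' i := by
  have hL : (∑ i, conj (∑ k, conj (K k l) * h k i) * ∑ k, conj (K k l') * h k i)
      = ∑ i, ∑ k, ∑ k', K k l * conj (K k' l') * (conj (h k i) * h k' i) := by
    refine Finset.sum_congr rfl fun i _ => ?_
    rw [map_sum, Finset.sum_mul]
    refine Finset.sum_congr rfl fun k _ => ?_
    rw [Finset.mul_sum]
    refine Finset.sum_congr rfl fun k' _ => ?_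
    rw [map_mul, Complex.conj_conj]; ring
  have hR : (∑ k, ∑ k', K k l * conj (K k' l') * ∑ i, conj (h k i) * h k' i)
      = ∑ k, ∑ k', ∑ i, K k l * conj (K k' l') * (conj (h k i) * h k' i) := by
    refine Finset.sum_congr rfl fun k _ => Finset.sum_congr rfl fun k' _ => ?_
    rw [Finset.mul_sum]
  have s1 : (∑ k, ∑ k', ∑ i, K k l * conj (K k' l') * (conj (h k i) * h k' i))
      = ∑ k, ∑ i, ∑ k', K k l * conj (K k' l') * (conj (h k i) * h k' i) :=
    Finset.sum_congr rfl fun k _ => Finset.sum_comm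
  have s2 : (∑ k, ∑ i, ∑ k', K k l * conj (K k' l') * (conj (h k i) * h k' i))
      = ∑ i, ∑ k, ∑ k', K k l * conj (K k' l') * (conj (h k i) * h k' i) := Finset.sum_comm
  rw [hL, hR, s1, s2]

/-- **Key lemma, balanced case (unit form).** For HS-orthonormal `Q`, an orthonormal pair `w 0, w 1` in
`ℂ^{2×2}` which is balanced (`∑_r ∑_k |w r (k,0)|² = 1`), and orthonormal `b 0 ⊥ b 1`: with
`h k i = Q_k* b_i`, `A r = ∑_k conj(w r (k,0)) h k 0`, `B r = ∑_k conj(w r (k,1)) h k 1`: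
`|∑_r ⟪A r, B r⟫|² ≤ (1 − ∑_r ‖A r‖²)(1 − ∑_r ‖B r‖²)` with both factors nonnegative. -/
theorem key_case_BAL_unit {κ μ : Type*} [Fintype κ] [Fintype μ]
    (Q : Fin 2 → κ × μ → ℂ) (hQ : ∀ k l, (∑ c, conj (Q k c) * Q l c) = if k = l then 1 else 0)
    (w : Fin 2 → Fin 2 × Fin 2 → ℂ) (hw : ∀ r s, (∑ a, conj (w r a) * w s a) = if r = s then 1 else 0)
    (hbal : (∑ r, ∑ k, ‖w r (k, 0)‖ ^ 2) = 1)
    (b : Fin 2 → κ → ℂ) (hb₀ : (∑ m, ‖b 0 m‖ ^ 2) = 1) (hb₁ : (∑ m, ‖b 1 m‖ ^ 2) = 1)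
    (hb : (∑ m, conj (b 0 m) * b 1 m) = 0) :
    let h : Fin 2 → Fin 2 → μ → ℂ := fun k i c => ∑ m, conj (Q k (m, c)) * b i m
    let A : Fin 2 → μ → ℂ := fun r c => ∑ k, conj (w r (k, 0)) * h k 0 c
    let B : Fin 2 → μ → ℂ := fun r c => ∑ k, conj (w r (k, 1)) * h k 1 c
    ‖∑ r, ∑ c, conj (A r c) * B r c‖ ^ 2 ≤ (1 - ∑ r, ∑ c, ‖A r c‖ ^ 2) * (1 - ∑ r, ∑ c, ‖B r c‖ ^ 2)
      ∧ 0 ≤ 1 - ∑ r, ∑ c, ‖A r c‖ ^ 2 ∧ 0 ≤ 1 - ∑ r, ∑ c, ‖B r c‖ ^ 2 := by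
  intro h A B
  -- the 2×2 data
  set E₀ : Matrix (Fin 2) (Fin 2) ℂ := Matrix.of fun k r => w r (k, 0) with hE₀
  set E₁ : Matrix (Fin 2) (Fin 2) ℂ := Matrix.of fun k r => w r (k, 1) with hE₁
  set D : Matrix (Fin 2) (Fin 2) ℂ :=
    Matrix.of fun k l : Fin 2 => ∑ c, conj (∑ m, conj (Q l (m, c)) * b 0 m) * ∑ m, conj (Q k (m, c)) * b 0 m with hD
  set D₁ : Matrix (Fin 2) (Fin 2) ℂ :=
    Matrix.of fun k l : Fin 2 => ∑ c, conj (∑ m, conj (Q l (m, c)) * b 1 m) * ∑ m, conj (Q k (m, c)) * b 1 m with hD₁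
  have hDh : D = Matrix.of fun k l : Fin 2 => ∑ c, conj (h l 0 c) * h k 0 c := rfl
  have hD₁h : D₁ = Matrix.of fun k l : Fin 2 => ∑ c, conj (h l 1 c) * h k 1 c := rfl
  set K : Matrix (Fin 2) (Fin 2) ℂ := E₀ * E₁ᴴ with hK
  set c₀ : ℂ := ∑ r, ∑ c, conj (A r c) * B r c with hc₀
  -- hypotheses of bal_chain
  have hiso : E₀ᴴ * E₀ + E₁ᴴ * E₁ = 1 := by
    ext r s
    have hrs := hw r s
    rw [Fintype.sum_prod_type] at hrs
    simp only [Fin.sum_univ_two, Finset.sum_add_distrib] at hrs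
    simp only [Matrix.add_apply, Matrix.mul_apply, Matrix.conjTranspose_apply, hE₀, hE₁, Matrix.of_apply,
      Complex.star_def, Matrix.one_apply]
    rw [← hrs]
    simp only [Fin.sum_univ_two]
  have hbalC : (E₀ᴴ * E₀).trace = 1 := by
    rw [Matrix.trace]
    simp only [Matrix.diag_apply, Matrix.mul_apply, Matrix.conjTranspose_apply, hE₀, Matrix.of_apply, Complex.star_def,
      Complex.conj_mul']
    exact_mod_cast hbal
  have hDpsd : D.PosSemidef := by rw [hDh]; exact gram_psd_fin_two (fun k => h k 0)
  have hD₁psd : D₁.PosSemidef := by rw [hD₁h]; exact gram_psd_fin_two (fun k => h k 1)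
  have hsum : (1 - D - D₁).PosSemidef := one_sub_grams_psd Q hQ b hb₀ hb₁ hb
  -- the K-twisted family and the von Neumann bound
  set aa : Fin 2 → μ → ℂ := fun l c => ∑ k, conj (K k l) * h k 0 c with haa
  have hK_apply : ∀ k l, K k l = ∑ r, w r (k, 0) * conj (w r (l, 1)) := by
    intro k l
    simp only [hK, hE₀, hE₁, Matrix.mul_apply, Matrix.conjTranspose_apply, Matrix.of_apply, Complex.star_def]
  have hip : ∀ l l', (∑ i, conj (aa l i) * aa l' i)
      = ∑ k, ∑ k', K k l * conj (K k' l') * ∑ i, conj (h k 0 i) * h k' 0 i := by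
    intro l l'; simp only [haa]; exact ip_twist K (fun k => h k 0) l l'
  -- c₀ in K-form
  have hc₀K : c₀ = ∑ l, ∑ i, conj (aa l i) * h l 1 i := by
    -- both sides equal ∑ i ∑ k ∑ l ∑ r  w r (k,0) conj(w r (l,1)) conj(h k 0 i) h l 1 i
    have L : c₀ = ∑ i, ∑ k, ∑ l, ∑ r, w r (k, 0) * conj (w r (l, 1)) * (conj (h k 0 i) * h l 1 i) := by
      have : c₀ = ∑ r, ∑ i, ∑ k, ∑ l, w r (k, 0) * conj (w r (l, 1)) * (conj (h k 0 i) * h l 1 i) := by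
        rw [hc₀]
        refine Finset.sum_congr rfl fun r _ => Finset.sum_congr rfl fun i _ => ?_
        change conj (∑ k, conj (w r (k, 0)) * h k 0 i) * (∑ l, conj (w r (l, 1)) * h l 1 i) = _
        rw [map_sum, Finset.sum_mul]
        refine Finset.sum_congr rfl fun k _ => ?_
        rw [Finset.mul_sum]
        refine Finset.sum_congr rfl fun l _ => ?_
        rw [map_mul, Complex.conj_conj]; ring
      rw [this, Finset.sum_comm]
      refine Finset.sum_congr rfl fun i _ => ?_
      rw [Finset.sum_comm]
      refine Finset.sum_congr rfl fun k _ => ?_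
      rw [Finset.sum_comm]
    have R : (∑ l, ∑ i, conj (aa l i) * h l 1 i)
        = ∑ i, ∑ k, ∑ l, ∑ r, w r (k, 0) * conj (w r (l, 1)) * (conj (h k 0 i) * h l 1 i) := by
      have : (∑ l, ∑ i, conj (aa l i) * h l 1 i)
          = ∑ l, ∑ i, ∑ k, ∑ r, w r (k, 0) * conj (w r (l, 1)) * (conj (h k 0 i) * h l 1 i) := by
        refine Finset.sum_congr rfl fun l _ => Finset.sum_congr rfl fun i _ => ?_
        simp only [haa, map_sum, map_mul, Complex.conj_conj, Finset.sum_mul, hK_apply]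
        refine Finset.sum_congr rfl fun k _ => Finset.sum_congr rfl fun r _ => ?_
        ring
      rw [this, Finset.sum_comm]
      refine Finset.sum_congr rfl fun i _ => ?_
      rw [Finset.sum_comm]
    rw [L, R]
  have hvn := vn2 (h 0 1) (h 1 1) (aa 0) (aa 1)
  rw [show (∑ i, conj (aa 0 i) * h 0 1 i) + ∑ i, conj (aa 1 i) * h 1 1 i = c₀ by
    rw [hc₀K, Fin.sum_univ_two]] at hvn
  -- complex atoms
  have normsq_eq_re : ∀ v : μ → ℂ, (∑ i, ‖v i‖ ^ 2 : ℝ) = (∑ i, conj (v i) * v i).re := by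
    intro v; rw [Complex.re_sum]; exact Finset.sum_congr rfl fun i _ => by
      rw [Complex.conj_mul', ← Complex.ofReal_pow, Complex.ofReal_re]
  have ip_conj : ∀ u v : μ → ℂ, (∑ i, conj (u i) * v i) = conj (∑ i, conj (v i) * u i) := by
    intro u v; rw [map_sum]; exact Finset.sum_congr rfl fun i _ => by rw [map_mul, Complex.conj_conj, mul_comm]
  -- the trace identity:  T = Re tr(D K D₁ Kᴴ)
  have htrC : (D * K * D₁ * Kᴴ).trace
      = ∑ l, ∑ l', (∑ i, conj (aa l i) * aa l' i) * ∑ i, conj (h l' 1 i) * h l 1 i := by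
    simp only [hip, Matrix.trace_fin_two, Matrix.mul_apply, Matrix.conjTranspose_apply,
      Complex.star_def, hDh, hD₁h, Matrix.of_apply, Fin.sum_univ_two]
    ring
  have hT : (∑ i, ‖h 0 1 i‖ ^ 2) * (∑ i, ‖aa 0 i‖ ^ 2) + (∑ i, ‖h 1 1 i‖ ^ 2) * (∑ i, ‖aa 1 i‖ ^ 2)
        + 2 * ((∑ i, conj (h 0 1 i) * h 1 1 i) * ∑ i, conj (aa 1 i) * aa 0 i).re
      = ((D * K * D₁ * Kᴴ).trace).re := by
    rw [htrC]
    simp only [Fin.sum_univ_two, Complex.add_re]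
    rw [normsq_eq_re (h 0 1), normsq_eq_re (h 1 1), normsq_eq_re (aa 0), normsq_eq_re (aa 1)]
    have r1 : ((∑ i, conj (aa 0 i) * aa 0 i) * ∑ i, conj (h 0 1 i) * h 0 1 i).re
        = (∑ i, conj (h 0 1 i) * h 0 1 i).re * (∑ i, conj (aa 0 i) * aa 0 i).re := by
      rw [Complex.mul_re]
      have h1 : (∑ i, conj (aa 0 i) * aa 0 i).im = 0 := by
        rw [Complex.im_sum]; exact Finset.sum_eq_zero fun i _ => by rw [Complex.conj_mul', ← Complex.ofReal_pow, Complex.ofReal_im]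
      rw [h1]; ring
    have r2 : ((∑ i, conj (aa 1 i) * aa 1 i) * ∑ i, conj (h 1 1 i) * h 1 1 i).re
        = (∑ i, conj (h 1 1 i) * h 1 1 i).re * (∑ i, conj (aa 1 i) * aa 1 i).re := by
      rw [Complex.mul_re]
      have h1 : (∑ i, conj (aa 1 i) * aa 1 i).im = 0 := by
        rw [Complex.im_sum]; exact Finset.sum_eq_zero fun i _ => by rw [Complex.conj_mul', ← Complex.ofReal_pow, Complex.ofReal_im]
      rw [h1]; ring
    have r3 : ((∑ i, conj (aa 0 i) * aa 1 i) * ∑ i, conj (h 1 1 i) * h 0 1 i).re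
        = ((∑ i, conj (h 0 1 i) * h 1 1 i) * ∑ i, conj (aa 1 i) * aa 0 i).re := by
      rw [ip_conj (aa 0) (aa 1), ip_conj (h 1 1) (h 0 1), ← map_mul, Complex.conj_re, mul_comm]
    rw [r1, r2, r3]
    ring
  -- the determinant identity
  have hdetD₁eq : (∑ i, ‖h 0 1 i‖ ^ 2) * (∑ i, ‖h 1 1 i‖ ^ 2) - ‖∑ i, conj (h 0 1 i) * h 1 1 i‖ ^ 2 = (D₁.det).re := by
    rw [Matrix.det_fin_two, hD₁h]
    simp only [Matrix.of_apply]
    rw [normsq_eq_re (h 0 1), normsq_eq_re (h 1 1), Complex.sub_re, Complex.mul_re, Complex.sq_norm,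
      Complex.normSq_apply]
    have i0 : (∑ i, conj (h 0 1 i) * h 0 1 i).im = 0 := by
      rw [Complex.im_sum]; exact Finset.sum_eq_zero fun i _ => by rw [Complex.conj_mul', ← Complex.ofReal_pow, Complex.ofReal_im]
    rw [i0, ip_conj (h 0 1) (h 1 1), Complex.mul_re, Complex.conj_re, Complex.conj_im]
    ring
  have hdetaaeq : (∑ i, ‖aa 0 i‖ ^ 2) * (∑ i, ‖aa 1 i‖ ^ 2) - ‖∑ i, conj (aa 0 i) * aa 1 i‖ ^ 2
      = ‖K.det‖ ^ 2 * (D.det).re := by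
    -- over ℂ:  IP(aa0,aa0) IP(aa1,aa1) − IP(aa0,aa1) IP(aa1,aa0) = det K conj(det K) det D
    have hC : (∑ i, conj (aa 0 i) * aa 0 i) * (∑ i, conj (aa 1 i) * aa 1 i)
        - (∑ i, conj (aa 0 i) * aa 1 i) * (∑ i, conj (aa 1 i) * aa 0 i) = K.det * conj K.det * D.det := by
      simp only [hip, Matrix.det_fin_two, hDh, Matrix.of_apply, Fin.sum_univ_two, map_sub, map_mul]
      ring
    have hre := congrArg Complex.re hC
    rw [Complex.sub_re] at hre
    rw [normsq_eq_re (aa 0), normsq_eq_re (aa 1), Complex.sq_norm, Complex.normSq_apply]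
    have i0 : (∑ i, conj (aa 0 i) * aa 0 i).im = 0 := by
      rw [Complex.im_sum]; exact Finset.sum_eq_zero fun i _ => by rw [Complex.conj_mul', ← Complex.ofReal_pow, Complex.ofReal_im]
    have e1 : ((∑ i, conj (aa 0 i) * aa 0 i) * ∑ i, conj (aa 1 i) * aa 1 i).re
        = (∑ i, conj (aa 0 i) * aa 0 i).re * (∑ i, conj (aa 1 i) * aa 1 i).re := by
      rw [Complex.mul_re, i0]; ring
    have e2 : ((∑ i, conj (aa 0 i) * aa 1 i) * ∑ i, conj (aa 1 i) * aa 0 i).re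
        = (∑ i, conj (aa 0 i) * aa 1 i).re * (∑ i, conj (aa 0 i) * aa 1 i).re
          + (∑ i, conj (aa 0 i) * aa 1 i).im * (∑ i, conj (aa 0 i) * aa 1 i).im := by
      rw [ip_conj (aa 1) (aa 0), Complex.mul_re, Complex.conj_re, Complex.conj_im]; ring
    have e3 : (K.det * conj K.det * D.det).re = ‖K.det‖ ^ 2 * (D.det).re := by
      rw [Complex.mul_conj', ← Complex.ofReal_pow, Complex.re_ofReal_mul]
    rw [e1, e2, e3] at hre
    linarith
  -- assemble hV
  have hdetD : 0 ≤ (D.det).re := (Complex.nonneg_iff.1 hDpsd.det_nonneg).1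
  have hdetD₁ : 0 ≤ (D₁.det).re := (Complex.nonneg_iff.1 hD₁psd.det_nonneg).1
  have hV : ‖c₀‖ ^ 2 ≤ ((D * (E₀ * E₁ᴴ) * D₁ * (E₀ * E₁ᴴ)ᴴ).trace).re
      + 2 * ‖(E₀ * E₁ᴴ).det‖ * Real.sqrt ((D.det).re * (D₁.det).re) := by
    rw [← hK, ← hT]
    have hs : Real.sqrt (((∑ i, ‖h 0 1 i‖ ^ 2) * (∑ i, ‖h 1 1 i‖ ^ 2) - ‖∑ i, conj (h 0 1 i) * h 1 1 i‖ ^ 2)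
        * ((∑ i, ‖aa 0 i‖ ^ 2) * (∑ i, ‖aa 1 i‖ ^ 2) - ‖∑ i, conj (aa 0 i) * aa 1 i‖ ^ 2))
        = ‖K.det‖ * Real.sqrt ((D.det).re * (D₁.det).re) := by
      rw [hdetD₁eq, hdetaaeq]
      have : (D₁.det).re * (‖K.det‖ ^ 2 * (D.det).re) = ‖K.det‖ ^ 2 * ((D.det).re * (D₁.det).re) := by ring
      rw [this, Real.sqrt_mul (by positivity), Real.sqrt_sq (norm_nonneg _)]
    rw [hs] at hvn
    linarith
  have hchain := bal_chain E₀ E₁ D D₁ c₀ hiso hbalC hDpsd hD₁psd hsum hV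
  -- identify the factors:  Re tr(E₀E₀ᴴ (1 − D)) = 1 − ∑_r ‖A r‖²  etc.
  have hPD : ((E₀ * E₀ᴴ) * D).trace = ∑ r, ∑ i, conj (A r i) * A r i := by
    have eA : ∀ r r', (∑ i, conj (A r i) * A r' i) = ∑ k, ∑ k', E₀ k r * conj (E₀ k' r') * ∑ i, conj (h k 0 i) * h k' 0 i := by
      intro r r'
      have := ip_twist E₀ (fun k => h k 0) r r'
      simp only [hE₀, Matrix.of_apply] at this ⊢
      exact this
    simp only [eA, Matrix.trace_fin_two, Matrix.mul_apply, Matrix.conjTranspose_apply, Complex.star_def, hDh,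
      Matrix.of_apply, Fin.sum_univ_two, hE₀]
    ring
  have hQD : ((E₁ * E₁ᴴ) * D₁).trace = ∑ r, ∑ i, conj (B r i) * B r i := by
    have eB : ∀ r r', (∑ i, conj (B r i) * B r' i) = ∑ k, ∑ k', E₁ k r * conj (E₁ k' r') * ∑ i, conj (h k 1 i) * h k' 1 i := by
      intro r r'
      have := ip_twist E₁ (fun k => h k 1) r r'
      simp only [hE₁, Matrix.of_apply] at this ⊢
      exact this
    simp only [eB, Matrix.trace_fin_two, Matrix.mul_apply, Matrix.conjTranspose_apply, Complex.star_def, hD₁h,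
      Matrix.of_apply, Fin.sum_univ_two, hE₁]
    ring
  obtain ⟨_, _, _, _, _, htrP, htrQ⟩ := balanced_blocks E₀ E₁ hiso hbalC
  have f1 : (((E₀ * E₀ᴴ) * (1 - D)).trace).re = 1 - ∑ r, ∑ c, ‖A r c‖ ^ 2 := by
    rw [Matrix.mul_sub, Matrix.mul_one, Matrix.trace_sub, Complex.sub_re, htrP, Complex.one_re, hPD, Complex.re_sum]
    congr 1
    exact Finset.sum_congr rfl fun r _ => (normsq_eq_re (A r)).symm
  have f2 : (((E₁ * E₁ᴴ) * (1 - D₁)).trace).re = 1 - ∑ r, ∑ c, ‖B r c‖ ^ 2 := by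
    rw [Matrix.mul_sub, Matrix.mul_one, Matrix.trace_sub, Complex.sub_re, htrQ, Complex.one_re, hQD, Complex.re_sum]
    congr 1
    exact Finset.sum_congr rfl fun r _ => (normsq_eq_re (B r)).symm
  -- nonnegativity of the factors
  have hPpsd : (E₀ * E₀ᴴ).PosSemidef := Matrix.posSemidef_self_mul_conjTranspose E₀
  have hQpsd : (E₁ * E₁ᴴ).PosSemidef := Matrix.posSemidef_self_mul_conjTranspose E₁
  have h1D : (1 - D).PosSemidef := by
    have := hsum.add hD₁psd; simpa only [sub_add_cancel] using this
  have h1D₁ : (1 - D₁).PosSemidef := by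
    have := hsum.add hDpsd
    have e : 1 - D - D₁ + D = 1 - D₁ := by abel
    simpa only [e] using this
  have n1 := trace_mul_re_nonneg_fin_two _ _ hPpsd h1D
  have n2 := trace_mul_re_nonneg_fin_two _ _ hQpsd h1D₁
  rw [f1] at n1 hchain
  rw [f2] at n2 hchain
  exact ⟨hchain, n1, n2⟩

end Summit.MatrixMultiplication.MatrixMultiplication.Theorems.RankTwoAdditivity
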